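import Summits.QuantumFields.YangMills.Theorems.LuscherReductionTwistedTraceScalingValleyLinkProx
import Summits.QuantumFields.YangMills.Theorems.LuscherReductionTwistedTraceScalingBTKineticSquares
import Literature.MathematicalPhysics.QuantumFieldTheory.Balaban1983to89.T4WilsonGaugeFlatDirection
import HarnessLib

/-!
# Polynomial Łojasiewicz localisation of the periodic deficit, II: the comb tree path, the wrap commutators, flat comb configurations
# (helper file for the crux `ToronValleyVolume.LojasiewiczLocalise`, item stmt-QuantumFields-24498, LINE g15-B of ym-idea-4)

The spatial half of the localisation is lane A's comb propagation (✓`…CombTransport/…CombPropagation/…CombWraps/…CombFlat`): in the comb gauge `treeFix U` every link is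
within `(L−1)(6L−4)√(2S(U))` of the comb-flat configuration `combFlat (wrapReps U)` (✓`fd_treeFix_combFlat_le`) and the three wrap representatives almost commute
(✓`fd_comm01_le`, `fd_comm12_le`, `fd_comm02_le`).  This file adds what the RING version (2L time slices + a seam gauge field) needs on top:
* §1 the Frobenius link distance `fd` versus the quaternion distance: `fd V W² = 2‖q V − q W‖²`, so `‖q V − q W‖ ≤ fd V W ≤ 2‖q V − q W‖`;
* §2 ★ `fd_sub_base_le_of_treeEdge` — a site field whose jumps across the comb's TREE edges are `≤ R` is within `3(L−1)R` of its value at the origin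
  (the seam gauge field of a small-deficit ring nearly stabilises the comb-gauge slice, hence is nearly constant);
* §3 `fd_comm_wrapReps_le` — all wrap commutators `‖w_i w_j w_i⁻¹ w_j⁻¹ − 1‖_F ≤ combC L·√(2S)` (the three boundary plaquettes, packaged for every pair);
* §4 `plaquetteHolonomy_combFlat`, ★ `wilsonAction_combFlat_eq_zero` — a comb-flat configuration with pairwise COMMUTING wraps is flat; with a constant gauge
  field commuting with the wraps it is fixed (✓`gaugeTransform_const_combFlat`);
* §5 `exists_su2_family_of_unit_quaternions` — a commuting family of unit quaternions is the `su2Quat`-image of a commuting family in `SU(2)`.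
HONEST FRAMING: lattice/group bookkeeping (classical, zero-ℏ); the crux, ⟨24497⟩, the leaf `PeriodicSoftness` and Yang–Mills stay OPEN here.  THEOREMS ONLY (no
definition, no `sorry`).
-/

set_option autoImplicit false

noncomputable section

open scoped Quaternion Matrix BigOperators
open Literature.MathematicalPhysics.QuantumFieldTheory hiding SU2
open Literature.MathematicalPhysics.QuantumLattice

namespace Summit.QuantumFields.YangMills.Theorems.ToronValleyVolume.Lojasiewicz

open Summit.QuantumFields.YangMills.Theorems.FemtoTransferGap
open Summit.QuantumFields.YangMills.Theorems.FemtoTransferGap.TT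
open Summit.QuantumFields.YangMills.Theorems.FemtoTransferGap.TwoLattice
open Summit.QuantumFields.YangMills.Theorems.FemtoTransferGap.TwoLattice.Flat
open Summit.QuantumFields.YangMills.Theorems.FemtoTransferGap.TwoLattice.Cov

variable {L : ℕ}

/-! ## §1 Frobenius versus quaternion distance -/

/-- `fd V W² = 2·‖q V − q W‖²`. [cite: MontvayMunster1994, §3.2.3 (3.97)] -/
theorem fd_sq_eq_two_mul (V W : SU2) : fd V W ^ 2 = 2 * ‖su2Quat V - su2Quat W‖ ^ 2 := by
  unfold fd
  rw [frobNorm_sub_sq_eq]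
  have h1 := ConstTube.scalarPart_mul_inv V W
  have h2 := ConstTube.scalarPart_mul_inv_eq_one_sub V W
  linarith

/-- `‖q V − q W‖ ≤ fd V W`. [folklore] -/
theorem norm_su2Quat_sub_le_fd (V W : SU2) : ‖su2Quat V - su2Quat W‖ ≤ fd V W := by
  have h := fd_sq_eq_two_mul V W
  have h0 : 0 ≤ fd V W := frobNorm_nonneg _
  nlinarith [norm_nonneg (su2Quat V - su2Quat W)]

/-- `fd V W ≤ 2‖q V − q W‖`. [folklore] -/
theorem fd_le_two_mul_norm_su2Quat_sub (V W : SU2) : fd V W ≤ 2 * ‖su2Quat V - su2Quat W‖ := by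
  have h := fd_sq_eq_two_mul V W
  have h0 : 0 ≤ fd V W := frobNorm_nonneg _
  nlinarith [norm_nonneg (su2Quat V - su2Quat W)]

/-- `2 − Re tr(V W⁻¹) ≤ fd V W²` (the chordal deficit of a pair of links is dominated by the squared Frobenius distance). [folklore] -/
theorem two_sub_re_trace_mul_inv_le_fd_sq (V W : SU2) : 2 - ((su2Rep (V * W⁻¹)).trace).re ≤ fd V W ^ 2 := by
  rw [ConstTube.re_trace_su2Rep_mul_inv_eq_norm, fd_sq_eq_two_mul]
  nlinarith [sq_nonneg ‖su2Quat V - su2Quat W‖]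

/-- `‖q V − q W‖² = 2 − Re tr(V W⁻¹)` read as a bound: `‖q V − q W‖ ≤ √t` whenever `2 − Re tr(V W⁻¹) ≤ t`. [folklore] -/
theorem norm_su2Quat_sub_le_sqrt {V W : SU2} {t : ℝ} (h : 2 - ((su2Rep (V * W⁻¹)).trace).re ≤ t) : ‖su2Quat V - su2Quat W‖ ≤ Real.sqrt t := by
  rw [ConstTube.re_trace_su2Rep_mul_inv_eq_norm] at h
  have : ‖su2Quat V - su2Quat W‖ ^ 2 ≤ t := by linarith
  exact Real.le_sqrt_of_sq_le this

/-- The commutator defect in quaternion form is dominated by the Frobenius commutator defect: `‖q a q b − q b q a‖ ≤ ‖aba⁻¹b⁻¹ − 1‖_F`. [folklore] -/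
theorem norm_quat_comm_le_fd (a b : SU2) : ‖su2Quat a * su2Quat b - su2Quat b * su2Quat a‖ ≤ fd (a * b * a⁻¹ * b⁻¹) 1 := by
  have h1 : ‖su2Quat a * su2Quat b - su2Quat b * su2Quat a‖ = ‖su2Quat (a * b) - su2Quat (b * a)‖ := by rw [su2Quat_mul, su2Quat_mul]
  rw [h1]
  refine (norm_su2Quat_sub_le_fd _ _).trans_eq ?_
  rw [← fd_mul_inv_one (a * b) (b * a)]
  congr 1; group

/-! ## §2 The comb tree path -/

/-- ★ **Tree-path bound.**  If `g : Site → SU(2)` satisfies `‖g(x + e_k) − g(x)‖_F ≤ R` across every TREE edge `(x,k)` of the comb (✓`treeEdge`), then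
`‖g x − g 0‖_F ≤ 3(L−1)·R` for every site (the comb path `0 → (x₀,0,0) → (x₀,x₁,0) → x` has `x₀.val + x₁.val + x₂.val ≤ 3(L−1)` edges). [folklore] -/
theorem fd_sub_base_le_of_treeEdge [NeZero L] {g : Site 3 L → SU2} {R : ℝ} (hR : 0 ≤ R)
    (h : ∀ e : Edge 3 L, treeEdge e = true → fd (g (e.1.shift e.2)) (g e.1) ≤ R) (x : Site 3 L) :
    fd (g x) (g 0) ≤ 3 * ((L : ℝ) - 1) * R := by
  -- leg 0: from `0` to `base1 x`
  have leg0 : fd (g (base1 x)) (g 0) ≤ (x 0).val * R := by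
    have ht := fd_telescope (fun m => g (lineSite (0 : Site 3 L) 0 m)) (c := R) (x 0).val (fun m hm => ?_)
    · have e : lineSite (0 : Site 3 L) 0 (x 0).val = base1 x := by rw [lineSite, ZMod.natCast_zmod_val, zero_add_single]
      rwa [lineSite_zero, e] at ht
    · have := h (lineSite (0 : Site 3 L) 0 m, 0) (treeEdge_zero hm)
      rwa [lineSite_shift] at this
  -- leg 1: from `base1 x` to `base2 x`
  have leg1 : fd (g (base2 x)) (g (base1 x)) ≤ (x 1).val * R := by
    have ht := fd_telescope (fun m => g (lineSite (base1 x) 1 m)) (c := R) (x 1).val (fun m hm => ?_)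
    · rwa [lineSite_zero, lineSite_base1] at ht
    · have := h (lineSite (base1 x) 1 m, 1) (treeEdge_one (by rw [base1_apply]; simp) (by rw [base1_apply]; simp) hm)
      rwa [lineSite_shift] at this
  -- leg 2: from `base2 x` to `x`
  have leg2 : fd (g x) (g (base2 x)) ≤ (x 2).val * R := by
    have ht := fd_telescope (fun m => g (lineSite (base2 x) 2 m)) (c := R) (x 2).val (fun m hm => ?_)
    · rwa [lineSite_zero, lineSite_base2] at ht
    · have := h (lineSite (base2 x) 2 m, 2) (treeEdge_two (by rw [base2_apply]; simp) hm)
      rwa [lineSite_shift] at this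
  have h0 := val_le_pred (x 0)
  have h1 := val_le_pred (x 1)
  have h2 := val_le_pred (x 2)
  calc fd (g x) (g 0) ≤ fd (g x) (g (base2 x)) + (fd (g (base2 x)) (g (base1 x)) + fd (g (base1 x)) (g 0)) :=
        (fd_triangle _ _ _).trans (add_le_add le_rfl (fd_triangle _ _ _))
    _ ≤ (x 2).val * R + ((x 1).val * R + (x 0).val * R) := add_le_add leg2 (add_le_add leg1 leg0)
    _ ≤ ((L : ℝ) - 1) * R + (((L : ℝ) - 1) * R + ((L : ℝ) - 1) * R) := by
        refine add_le_add ?_ (add_le_add ?_ ?_) <;> exact mul_le_mul_of_nonneg_right (by assumption) hR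
    _ = 3 * ((L : ℝ) - 1) * R := by ring

/-! ## §3 The wrap representatives almost commute (all pairs) -/

/-- **All wrap commutators are within `combC L·√(2S(U))` of `1`** (✓`fd_comm01_le`, `fd_comm12_le`, `fd_comm02_le` and their inverses; the diagonal is `0`).
[cite: Luscher1983, §2] -/
theorem fd_comm_wrapReps_le [NeZero L] (U : GaugeConfig 3 L SU2) (i j : Fin 3) :
    fd (wrapReps U i * wrapReps U j * (wrapReps U i)⁻¹ * (wrapReps U j)⁻¹) 1 ≤ combC L * Real.sqrt (2 * wilsonAction su2Rep U) := by
  have hL : (1 : ℝ) ≤ L := by exact_mod_cast NeZero.one_le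
  set s := Real.sqrt (2 * wilsonAction su2Rep U) with hs
  have hs0 : 0 ≤ s := Real.sqrt_nonneg _
  have hL0 : 0 ≤ (L : ℝ) - 1 := by linarith
  have hw0 : wrapReps U 0 = treeFix U (mk3 (-1) 0 0, 0) := rfl
  have hw1 : wrapReps U 1 = treeFix U (mk3 0 (-1) 0, 1) := rfl
  have hw2 : wrapReps U 2 = treeFix U (mk3 0 0 (-1), 2) := rfl
  have c01 : fd (wrapReps U 0 * wrapReps U 1 * (wrapReps U 0)⁻¹ * (wrapReps U 1)⁻¹) 1 ≤ combC L * s := by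
    rw [hw0, hw1]
    refine (fd_comm01_le U).trans ?_
    rw [← hs]; unfold combC; nlinarith [mul_nonneg hL0 hs0]
  have c12 : fd (wrapReps U 1 * wrapReps U 2 * (wrapReps U 1)⁻¹ * (wrapReps U 2)⁻¹) 1 ≤ combC L * s := by
    rw [hw1, hw2]
    refine (fd_comm12_le U).trans ?_
    rw [← hs]; unfold combC; nlinarith [mul_nonneg hL0 hs0]
  have c02 : fd (wrapReps U 0 * wrapReps U 2 * (wrapReps U 0)⁻¹ * (wrapReps U 2)⁻¹) 1 ≤ combC L * s := by
    rw [hw0, hw2]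
    refine (fd_comm02_le U).trans ?_
    rw [← hs]; unfold combC; nlinarith [mul_nonneg hL0 hs0]
  -- inverse commutator: `‖(b a b⁻¹ a⁻¹) − 1‖ = ‖(a b a⁻¹ b⁻¹)⁻¹ − 1‖ = ‖a b a⁻¹ b⁻¹ − 1‖`
  have hinv : ∀ a b : SU2, fd (b * a * b⁻¹ * a⁻¹) 1 = fd (a * b * a⁻¹ * b⁻¹) 1 := fun a b => by
    rw [show b * a * b⁻¹ * a⁻¹ = (a * b * a⁻¹ * b⁻¹)⁻¹ by group, ← fd_inv, inv_inv, inv_one]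
  have hdiag : ∀ a : SU2, fd (a * a * a⁻¹ * a⁻¹) 1 ≤ combC L * s := fun a => by
    rw [mul_inv_cancel_right, mul_inv_cancel, fd_self]; exact mul_nonneg (le_trans zero_le_one one_le_combC) hs0
  have c10 := (hinv (wrapReps U 0) (wrapReps U 1)).trans_le c01
  have c21 := (hinv (wrapReps U 1) (wrapReps U 2)).trans_le c12
  have c20 := (hinv (wrapReps U 0) (wrapReps U 2)).trans_le c02
  fin_cases i <;> fin_cases j
  exacts [hdiag _, c01, c02, c10, hdiag _, c12, c20, c21, hdiag _]

/-! ## §4 Comb-flat configurations with commuting wraps are flat -/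

/-- The plaquette holonomy of a comb-flat configuration is a commutator of two of the values `{1, h i, h j}`. [folklore] -/
theorem plaquetteHolonomy_combFlat (h : Fin 3 → SU2) (x : Site 3 L) {i j : Fin 3} (hij : i ≠ j) :
    plaquetteHolonomy (combFlat (L := L) h) x i j = combFlat h (x, i) * combFlat h (x, j) * (combFlat h (x, i))⁻¹ * (combFlat h (x, j))⁻¹ := by
  unfold plaquetteHolonomy
  have h1 : combFlat (L := L) h (x.shift i, j) = combFlat h (x, j) := by
    rw [combFlat_apply, combFlat_apply]; dsimp only; simp_rw [shift_apply_ne x hij.symm]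
  have h2 : combFlat (L := L) h (x.shift j, i) = combFlat h (x, i) := by
    rw [combFlat_apply, combFlat_apply]; dsimp only; simp_rw [shift_apply_ne x hij]
  rw [h1, h2]

/-- With pairwise commuting wraps every plaquette holonomy of `combFlat h` is `1`. [folklore] -/
theorem plaquetteHolonomy_combFlat_eq_one {h : Fin 3 → SU2} (hc : ∀ i j, h i * h j = h j * h i) (x : Site 3 L) {i j : Fin 3} (hij : i ≠ j) :
    plaquetteHolonomy (combFlat (L := L) h) x i j = 1 := by
  rw [plaquetteHolonomy_combFlat h x hij]
  have hcomm : combFlat (L := L) h (x, i) * combFlat h (x, j) = combFlat h (x, j) * combFlat h (x, i) := by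
    rw [combFlat_apply, combFlat_apply]; dsimp only
    split_ifs <;> simp [hc i j]
  rw [hcomm]; group

/-- ★ **A comb-flat configuration with pairwise commuting wraps is FLAT**: its Wilson action vanishes. [cite: Luscher1983, §2] -/
theorem wilsonAction_combFlat_eq_zero [NeZero L] {h : Fin 3 → SU2} (hc : ∀ i j, h i * h j = h j * h i) :
    wilsonAction su2Rep (combFlat (L := L) h) = 0 := by
  unfold wilsonAction
  refine Finset.sum_eq_zero fun p _ => ?_
  rw [plaquetteHolonomy_combFlat_eq_one hc p.1 (ne_of_lt p.2.2), map_one, Matrix.trace_one]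
  simp

/-- A constant gauge transformation commuting with the wraps fixes the comb-flat configuration. [folklore] -/
theorem gaugeTransform_const_combFlat_of_comm {h : Fin 3 → SU2} {c : SU2} (hc : ∀ k, c * h k = h k * c) :
    gaugeTransform (fun _ : Site 3 L => c) (combFlat (L := L) h) = combFlat h := by
  rw [gaugeTransform_const_combFlat]
  congr 1; funext k
  rw [hc k, mul_inv_cancel_right]

/-! ## §5 From commuting unit quaternions back to `SU(2)` -/

/-- A family of unit quaternions is the `su2Quat`-image of a family in `SU(2)`; products (hence commutation) transfer. [folklore] -/
theorem exists_su2_family_of_unit_quaternions {ι : Type*} (y : ι → ℍ) (hy : ∀ i, ‖y i‖ = 1) :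
    ∃ Y : ι → SU2, (∀ i, su2Quat (Y i) = y i) ∧ ∀ i j, y i * y j = y j * y i → Y i * Y j = Y j * Y i := by
  refine ⟨fun i => quatToSU2 (y i), fun i => ?_, fun i j hij => ?_⟩
  · have hne : y i ≠ 0 := by intro h0; have := hy i; rw [h0, norm_zero] at this; exact zero_ne_one this
    rw [Balaban1983to89.T4HaarSU2Translate.su2Quat_quatToSU2 hne, hy i, inv_one, one_smul]
  · have hi : su2Quat (quatToSU2 (y i)) = y i := by
      have hne : y i ≠ 0 := by intro h0; have := hy i; rw [h0, norm_zero] at this; exact zero_ne_one this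
      rw [Balaban1983to89.T4HaarSU2Translate.su2Quat_quatToSU2 hne, hy i, inv_one, one_smul]
    have hj : su2Quat (quatToSU2 (y j)) = y j := by
      have hne : y j ≠ 0 := by intro h0; have := hy j; rw [h0, norm_zero] at this; exact zero_ne_one this
      rw [Balaban1983to89.T4HaarSU2Translate.su2Quat_quatToSU2 hne, hy j, inv_one, one_smul]
    apply Balaban1983to89.T4WilsonGaugeFlatDirection.su2Quat_injective
    rw [su2Quat_mul, su2Quat_mul, hi, hj, hij]

end Summit.QuantumFields.YangMills.Theorems.ToronValleyVolume.Lojasiewicz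

end
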